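import Summits.QuantumFields.YangMills.Theorems.ColdExitSC.Negative.UniformExitFalseOfHeavyTwistExtras
import Summits.QuantumFields.YangMills.Theorems.ColdExitSC.Negative.UniformExitFalseOfHeavyTwistHeadline

/-!
# The heavy-twist wall pointed at THE NUMBER (file 5): the slots of record PX ∕ PXcof carry the proof obligation «no slow floor at SU(2)»

Unconditional sequel to the PX-squeeze `unitMap_decay_of_pinnedExit` (Extras, proved there modulo S1 ∧ window — both THEOREMS now:
`purityTwistBoundSU2_holds`, `twistWindowSU2_holds`).  Lens «negation» (ym-ir-idea-10): the wall `L > β/204` for every `1/24`-pure cold box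
at `SU(2)` (pointwise, all parities — `pure_box_is_long_holds`) is set against the slots of record, which pin their witnesses to `a(β)·L ≤ T`:

* `unitMap_decay_holds` — **PX(θ), `0 ≤ θ ≤ 1/24` ⇒ every floor-admissible unit map `a` at `SU(2)` (fundamental) has `a(β)·β < 204·T`
  eventually** (no hypothesis beyond PX itself).
* `noSlowFloor_of_pinnedExitAt` — equivalently **PX(θ) ⊢ `NoSlowFloorSU2`**: no unit map with `β·a(β) → ∞` satisfies the observable floors
  `LowerBounds SU(2) (fundamentalLatticeRep 2) a`.  `not_pinnedExitAt_of_slowFloor` — the refuter's form: ONE slow floor kills PX(θ) for every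
  `θ ∈ [0, 1/24]`.
* `noSlowFloor_of_pinnedExitsCofinal` ∕ `not_pinnedExitsCofinal_of_slowFloor` — the same for the COFINAL body PXcof (slot of record on
  stmt-QuantumFields-26930; body spelled verbatim as in `IR/Negative/PinnedExitVacuityThreshold.lean`, = the hypothesis of the landed
  `PinnedExitCofinal.ircofSC_of_pinnedExitsCofinal_le`).
* `not_pinnedExitsCofinalFree` ∕ `not_pinnedExitAtFree` — **PXcof(θ) and PX(θ) with the floor hypothesis `LowerBounds` DELETED are FALSE for every
  `θ ∈ [0, 1/24]`, unconditionally** (witness: `SU(2)`, fundamental, the slow unit `slowUnit β = 1/√(β ∨ 1)`).  Contrast the calibration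
  `PinnedExit96.Negative.pinnedExitAt_of_one_le` (`θ ≥ 1`: TRUE with the floor UNUSED): at the registered tolerance the floor is LOAD-BEARING —
  any proof of PX(1/24) ∕ PXcof(1/24) must USE `LowerBounds`, quantitatively, as the bound `β·a(β) = O(1)` (`_false_without_LowerBounds` in the
  Disproof idiom; same pattern as `AfPincerUc.SharpOnset.not_onsetSharpUKPcSCFree` for the slot I♯_SC).

READING (numbers, not adjectives).  True physics: `a(β) ≍ e^{−3π²β/11}` at `SU(2)`, so `β·a(β) → 0` and no tension — PX ∕ PXcof SURVIVE.  Information: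
any proof of either slot of record must, in particular, prove `NoSlowFloorSU2` — a weak-coupling DEGENERATION statement (the smeared truncated
two- and three-point functions of the action density at smearing scale `1/a(β) = o(β)` cannot stay `≥ ε` on all tori of side `≥ Λ₅/a(β)` at all large `β`);
conversely a refuter who CONSTRUCTS `LowerBounds` for one unit map with `β·a(β) → ∞` refutes PX(θ ≤ 1/24) and PXcof(θ ≤ 1/24) at once.  This answers the
calibration note of `PinnedExitVacuityThreshold` («a kernel `¬ PinnedExitAt θ` must exhibit `(G, r, a)` WITH a `LowerBounds` witness»): the witness class is
now named — slow floors at `SU(2)`.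

HONEST FRAMING: a wall theorem (width 0).  Nothing here proves or refutes PX(1/24), PXcof(1/24), `BalabanLadder.IR` (stmt-QuantumFields-19354, 0/1),
`IRcof` (stmt-QuantumFields-26930, 0/1) or the Yang–Mills mass gap (Clay — NOT proved anywhere in this tree); R4 closes only `BalabanLadder.UV`.
-/

set_option autoImplicit false

noncomputable section

open Filter Topology
open Literature.MathematicalPhysics.QuantumFieldTheory Literature.MathematicalPhysics.QuantumLattice
open Summit.QuantumFields.YangMills.Cruxes.IR.ColdPurityBridge (coldDefect)
open Summit.QuantumFields.YangMills.Cruxes.IR.PinnedExit96 (PinnedExitAt)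
open Summit.QuantumFields.YangMills.Cruxes.OSLegsFromFemtoAndGap.DlrCollarTransfer (LowerBounds)
open Summit.QuantumFields.YangMills.Theorems.BrascampLiebVacuumSC.Negative (simplyConnectedSpace_su2)

namespace Summit.QuantumFields.YangMills.Theorems.ColdExitSC.Negative.HeavyTwist

/-- `SU(2)` is compact simple (tree, by name). -/
private theorem su2_simple : IsCompactSimpleLieGroup (Matrix.specialUnitaryGroup (Fin 2) ℂ) :=
  isCompactSimpleLieGroup_specialUnitaryGroup isSimpleCompactGroup_specialUnitaryGroup_holds le_rfl

/-- **THE WALL, POINTWISE AND UNCONDITIONAL (all parities):** for all large `β`, every cold `4:1` box of side `L ≥ 8` at `SU(2)` (fundamental)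
with purity defect `≤ 1/24` has `L > β/204`. -/
theorem pure_box_is_long_holds :
    letI : MeasurableSpace (Matrix.specialUnitaryGroup (Fin 2) ℂ) := borel _
    haveI : BorelSpace (Matrix.specialUnitaryGroup (Fin 2) ℂ) := ⟨rfl⟩
    ∃ β₀ : ℝ, ∀ β : ℝ, β₀ ≤ β → ∀ L : ℕ, 8 ≤ L →
      coldDefect (fundamentalLatticeRep 2).ρ β L ≤ 1 / 24 → β / 204 < (L : ℝ) := by
  letI : MeasurableSpace (Matrix.specialUnitaryGroup (Fin 2) ℂ) := borel _
  haveI : BorelSpace (Matrix.specialUnitaryGroup (Fin 2) ℂ) := ⟨rfl⟩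
  have hB : PurityTwistBoundAt (fundamentalLatticeRep 2) minusOneSU2 0 := purityTwistBoundSU2_holds
  have hW : TwistWindowAt (fundamentalLatticeRep 2) minusOneSU2 0 204 (9 / 10) := twistWindowSU2_holds
  exact pure_box_is_long_all (fundamentalLatticeRep 2) hB (twistWindowBelow_of_at _ hW) le_rfl tolerance_of_record_clears

/-- **No slow floor at `SU(2)`** — the proof obligation the wall extracts from the slots of record: no unit map `a > 0`, `a → 0` with
`β·a(β) → ∞` satisfies the observable floors `LowerBounds` of the IR leaf at `SU(2)`, fundamental representation. -/
def NoSlowFloorSU2 : Prop :=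
  letI : MeasurableSpace (Matrix.specialUnitaryGroup (Fin 2) ℂ) := borel _
  haveI : BorelSpace (Matrix.specialUnitaryGroup (Fin 2) ℂ) := ⟨rfl⟩
  ∀ a : ℝ → ℝ, (∀ β, 0 < a β) → Tendsto a atTop (𝓝 0) → Tendsto (fun β => a β * β) atTop atTop →
    ¬ LowerBounds (Matrix.specialUnitaryGroup (Fin 2) ℂ) (fundamentalLatticeRep 2) a

/-- **PX(θ), `0 ≤ θ ≤ 1/24` ⇒ floor-admissible unit maps at `SU(2)` decay at least like `1/β`: `a(β)·β < 204·T` eventually (UNCONDITIONAL).** -/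
theorem unitMap_decay_holds {θ : ℝ} (hθ0 : 0 ≤ θ) (hθ : θ ≤ 1 / 24) (hP : PinnedExitAt θ) (a : ℝ → ℝ)
    (ha : ∀ β, 0 < a β) (ha0 : Tendsto a atTop (𝓝 0))
    (hLB : letI : MeasurableSpace (Matrix.specialUnitaryGroup (Fin 2) ℂ) := borel _
      haveI : BorelSpace (Matrix.specialUnitaryGroup (Fin 2) ℂ) := ⟨rfl⟩
      LowerBounds (Matrix.specialUnitaryGroup (Fin 2) ℂ) (fundamentalLatticeRep 2) a) :
    ∃ T : ℝ, ∀ᶠ β : ℝ in atTop, a β * β < 204 * T :=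
  unitMap_decay_of_pinnedExit purityTwistBoundSU2_holds twistWindowSU2_holds hθ
    (lt_of_le_of_lt (by gcongr) tolerance_of_record_clears) hP simplyConnectedSpace_su2 a ha ha0 hLB

/-- **PX(θ) ⊢ `NoSlowFloorSU2`** (`0 ≤ θ ≤ 1/24`; UNCONDITIONAL implication). -/
theorem noSlowFloor_of_pinnedExitAt {θ : ℝ} (hθ0 : 0 ≤ θ) (hθ : θ ≤ 1 / 24) (hP : PinnedExitAt θ) : NoSlowFloorSU2 := by
  intro a ha ha0 hslow hLB
  obtain ⟨T, hT⟩ := unitMap_decay_holds hθ0 hθ hP a ha ha0 hLB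
  obtain ⟨β, h1, h2⟩ := (hT.and (hslow.eventually_ge_atTop (204 * T))).exists
  exact absurd h1 (not_lt.mpr h2)

/-- **The refuter's form: ONE slow floor at `SU(2)` kills PX(θ) for every `θ ∈ [0, 1/24]`** — in particular the slot of record PX(1/24). -/
theorem not_pinnedExitAt_of_slowFloor (h : ¬ NoSlowFloorSU2) {θ : ℝ} (hθ0 : 0 ≤ θ) (hθ : θ ≤ 1 / 24) : ¬ PinnedExitAt θ :=
  fun hP => h (noSlowFloor_of_pinnedExitAt hθ0 hθ hP)

/-- **PXcof(θ) ⊢ `NoSlowFloorSU2`** — the COFINAL body of record (stmt-QuantumFields-26930's slot; verbatim the hypothesis of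
`PinnedExitCofinal.ircofSC_of_pinnedExitsCofinal_le`), `θ ≤ 1/24`: cofinally-pinned pure boxes + the pointwise wall leave no slow floor either. -/
theorem noSlowFloor_of_pinnedExitsCofinal {θ : ℝ} (hθ : θ ≤ 1 / 24)
    (hP : ∀ (G : Type) [Group G] [TopologicalSpace G] [IsTopologicalGroup G] [CompactSpace G],
      IsCompactSimpleLieGroup G → SimplyConnectedSpace G →
      letI : MeasurableSpace G := borel G
      haveI : BorelSpace G := ⟨rfl⟩
      ∀ (r : LatticeRep G) (a : ℝ → ℝ), (∀ β, 0 < a β) → Tendsto a atTop (𝓝 0) → LowerBounds G r a →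
        ∃ T : ℝ, ∀ β₁ : ℝ, ∃ β : ℝ, β₁ ≤ β ∧ ∃ L : ℕ, 8 ≤ L ∧ a β * (L : ℝ) ≤ T ∧ coldDefect r.ρ β L ≤ θ) :
    NoSlowFloorSU2 := by
  intro a ha ha0 hslow hLB
  letI : MeasurableSpace (Matrix.specialUnitaryGroup (Fin 2) ℂ) := borel _
  haveI : BorelSpace (Matrix.specialUnitaryGroup (Fin 2) ℂ) := ⟨rfl⟩
  obtain ⟨T, hT⟩ := hP _ su2_simple simplyConnectedSpace_su2 (fundamentalLatticeRep 2) a ha ha0 hLB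
  obtain ⟨β₀, hβ₀⟩ := pure_box_is_long_holds
  obtain ⟨β₂, hβ₂⟩ := Filter.eventually_atTop.1 (hslow.eventually_ge_atTop (204 * T))
  obtain ⟨β, hβ, L, hL, haL, hδ⟩ := hT (max β₀ β₂)
  have hlong : β / 204 < (L : ℝ) := hβ₀ β ((le_max_left _ _).trans hβ) L hL (hδ.trans hθ)
  have hbig : 204 * T ≤ a β * β := hβ₂ β ((le_max_right _ _).trans hβ)
  have h1 : a β * (β / 204) < a β * (L : ℝ) := mul_lt_mul_of_pos_left hlong (ha β)
  nlinarith

/-- **The refuter's form for the cofinal slot:** a slow floor at `SU(2)` kills PXcof(θ), `θ ≤ 1/24`. -/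
theorem not_pinnedExitsCofinal_of_slowFloor (h : ¬ NoSlowFloorSU2) {θ : ℝ} (hθ : θ ≤ 1 / 24) :
    ¬ (∀ (G : Type) [Group G] [TopologicalSpace G] [IsTopologicalGroup G] [CompactSpace G],
      IsCompactSimpleLieGroup G → SimplyConnectedSpace G →
      letI : MeasurableSpace G := borel G
      haveI : BorelSpace G := ⟨rfl⟩
      ∀ (r : LatticeRep G) (a : ℝ → ℝ), (∀ β, 0 < a β) → Tendsto a atTop (𝓝 0) → LowerBounds G r a →
        ∃ T : ℝ, ∀ β₁ : ℝ, ∃ β : ℝ, β₁ ≤ β ∧ ∃ L : ℕ, 8 ≤ L ∧ a β * (L : ℝ) ≤ T ∧ coldDefect r.ρ β L ≤ θ) :=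
  fun hP => h (noSlowFloor_of_pinnedExitsCofinal hθ hP)

/-! ## PX ∕ PXcof WITHOUT the floor are FALSE at the registered tolerance (the floor is load-bearing) -/

/-- **PXcof(θ) with `LowerBounds` deleted** (cofinal body of record, floor-free). -/
def PinnedExitsCofinalFree (θ : ℝ) : Prop :=
  ∀ (G : Type) [Group G] [TopologicalSpace G] [IsTopologicalGroup G] [CompactSpace G],
    IsCompactSimpleLieGroup G → SimplyConnectedSpace G →
    letI : MeasurableSpace G := borel G
    haveI : BorelSpace G := ⟨rfl⟩
    ∀ (r : LatticeRep G) (a : ℝ → ℝ), (∀ β, 0 < a β) → Tendsto a atTop (𝓝 0) →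
      ∃ T : ℝ, ∀ β₁ : ℝ, ∃ β : ℝ, β₁ ≤ β ∧ ∃ L : ℕ, 8 ≤ L ∧ a β * (L : ℝ) ≤ T ∧ coldDefect r.ρ β L ≤ θ

/-- **PX(θ) with `LowerBounds` deleted** (`PinnedExit96.PinnedExitAt θ` minus its floor hypothesis). -/
def PinnedExitAtFree (θ : ℝ) : Prop :=
  ∀ (G : Type) [Group G] [TopologicalSpace G] [IsTopologicalGroup G] [CompactSpace G],
    IsCompactSimpleLieGroup G → SimplyConnectedSpace G →
    letI : MeasurableSpace G := borel G
    haveI : BorelSpace G := ⟨rfl⟩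
    ∀ (r : LatticeRep G) (a : ℝ → ℝ), (∀ β, 0 < a β) → Tendsto a atTop (𝓝 0) →
      ∃ T β₁ : ℝ, ∀ β : ℝ, β₁ ≤ β → ∃ L : ℕ, 8 ≤ L ∧ a β * (L : ℝ) ≤ T ∧ coldDefect r.ρ β L ≤ θ

/-- Floor-free PX ⇒ floor-free PXcof (every large `β` ⇒ cofinally in `β`). -/
theorem pinnedExitsCofinalFree_of_pinnedExitAtFree {θ : ℝ} (h : PinnedExitAtFree θ) : PinnedExitsCofinalFree θ := by
  intro G _ _ _ _ hG hsc
  letI : MeasurableSpace G := borel G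
  haveI : BorelSpace G := ⟨rfl⟩
  intro r a ha ha0
  obtain ⟨T, β₁, hT⟩ := h G hG hsc r a ha ha0
  exact ⟨T, fun β₂ => ⟨max β₁ β₂, le_max_right _ _, hT _ (le_max_left _ _)⟩⟩

/-- PX ⇒ floor-free? No — the converse direction is the trivial one: floor-free PX ⇒ PX (the floor hypothesis is simply not used). -/
theorem pinnedExitAt_of_free {θ : ℝ} (h : PinnedExitAtFree θ) : PinnedExitAt θ := by
  intro G _ _ _ _ hG hsc
  letI : MeasurableSpace G := borel G
  haveI : BorelSpace G := ⟨rfl⟩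
  intro r a ha ha0 _hLB
  exact h G hG hsc r a ha ha0

/-- **The slow unit** `1/√(β ∨ 1)`: positive, `→ 0`, and `β · slowUnit β = √β → ∞`. -/
def slowUnit (β : ℝ) : ℝ := (Real.sqrt (max β 1))⁻¹

/-- The slow unit map `slowUnit β = 1/√(β ∨ 1)` is positive. -/
theorem slowUnit_pos (β : ℝ) : 0 < slowUnit β :=
  inv_pos.mpr (Real.sqrt_pos.mpr (lt_max_of_lt_right one_pos))

/-- `slowUnit β → 0` as `β → ∞`. -/
theorem tendsto_slowUnit : Tendsto slowUnit atTop (𝓝 0) :=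
  tendsto_inv_atTop_zero.comp
    (Real.tendsto_sqrt_atTop.comp (tendsto_atTop_mono (fun β => le_max_left β 1) tendsto_id))

/-- `β · slowUnit β → ∞` as `β → ∞` (the floor scale of the slow unit grows faster than any pin allows). -/
theorem tendsto_slowUnit_mul : Tendsto (fun β => slowUnit β * β) atTop atTop := by
  refine Real.tendsto_sqrt_atTop.congr' ?_
  filter_upwards [eventually_ge_atTop (1 : ℝ)] with β hβ
  have hmax : max β 1 = β := max_eq_left hβ
  have h0 : 0 ≤ β := zero_le_one.trans hβ
  have hs : 0 < Real.sqrt β := Real.sqrt_pos.mpr (lt_of_lt_of_le one_pos hβ)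
  simp only [slowUnit, hmax]
  rw [eq_comm, inv_mul_eq_iff_eq_mul₀ hs.ne']
  exact (Real.mul_self_sqrt h0).symm

/-- **PXcof WITHOUT THE FLOOR IS FALSE for `θ ≤ 1/24` (PROVED, unconditional):** at `SU(2)`, fundamental rep, the slow unit admits no cofinal
pin — pinned boxes have `L ≤ T·√β`, pure boxes have `L > β/204`. -/
theorem not_pinnedExitsCofinalFree {θ : ℝ} (hθ : θ ≤ 1 / 24) : ¬ PinnedExitsCofinalFree θ := by
  intro hF
  letI : MeasurableSpace (Matrix.specialUnitaryGroup (Fin 2) ℂ) := borel _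
  haveI : BorelSpace (Matrix.specialUnitaryGroup (Fin 2) ℂ) := ⟨rfl⟩
  obtain ⟨T, hT⟩ := hF _ su2_simple simplyConnectedSpace_su2 (fundamentalLatticeRep 2) slowUnit slowUnit_pos tendsto_slowUnit
  obtain ⟨β₀, hβ₀⟩ := pure_box_is_long_holds
  obtain ⟨β₂, hβ₂⟩ := Filter.eventually_atTop.1 (tendsto_slowUnit_mul.eventually_ge_atTop (204 * T))
  obtain ⟨β, hβ, L, hL, haL, hδ⟩ := hT (max β₀ β₂)
  have hlong : β / 204 < (L : ℝ) := hβ₀ β ((le_max_left _ _).trans hβ) L hL (hδ.trans hθ)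
  have hbig : 204 * T ≤ slowUnit β * β := hβ₂ β ((le_max_right _ _).trans hβ)
  have h1 : slowUnit β * (β / 204) < slowUnit β * (L : ℝ) := mul_lt_mul_of_pos_left hlong (slowUnit_pos β)
  nlinarith

/-- **PX WITHOUT THE FLOOR IS FALSE for `θ ≤ 1/24` (PROVED, unconditional)** — so `LowerBounds` is LOAD-BEARING in the slot of record PX(1/24)
(contrast `pinnedExitAt_of_one_le`: for `θ ≥ 1` PX holds with the floor unused). -/
theorem not_pinnedExitAtFree {θ : ℝ} (hθ : θ ≤ 1 / 24) : ¬ PinnedExitAtFree θ :=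
  fun h => not_pinnedExitsCofinalFree hθ (pinnedExitsCofinalFree_of_pinnedExitAtFree h)

/-- The slow unit is a slow floor candidate: `¬ NoSlowFloorSU2 ↔` SOME slow unit carries the floors; in particular
`LowerBounds SU(2) (fundamentalLatticeRep 2) slowUnit` alone would refute PX(θ ≤ 1/24) and PXcof(θ ≤ 1/24). -/
theorem not_noSlowFloor_of_lowerBounds_slowUnit
    (h : letI : MeasurableSpace (Matrix.specialUnitaryGroup (Fin 2) ℂ) := borel _
      haveI : BorelSpace (Matrix.specialUnitaryGroup (Fin 2) ℂ) := ⟨rfl⟩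
      LowerBounds (Matrix.specialUnitaryGroup (Fin 2) ℂ) (fundamentalLatticeRep 2) slowUnit) :
    ¬ NoSlowFloorSU2 :=
  fun hN => hN slowUnit slowUnit_pos tendsto_slowUnit tendsto_slowUnit_mul h

end Summit.QuantumFields.YangMills.Theorems.ColdExitSC.Negative.HeavyTwist

end
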